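import Summits.NavierStokesRegularity.NavierStokesRegularity.Theorems.ExtremiserTransienceNearExtremalTransienceExtremiserLiouvilleTruncationBounds
import Summits.NavierStokesRegularity.NavierStokesRegularity.Theorems.ExtremiserTransienceNearExtremalTransienceExtremiserLiouvilleRayAverage
import HarnessLib

/-!
# Crux `ExtremiserTransience.NearExtremalTransience` (stmt-NavierStokesRegularity-21883), line `extremiser_liouville`,
# stub K1b — DENSITY LEAF, part 4a: `L²` CONVERGENCE OF THE FIRST AND SECOND DERIVATIVES OF THE TRUNCATION ERROR

`--supports stmt-NavierStokesRegularity-21883` (helper).  Author: prover seat `ns-el-k1b` (g2).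

For a `C^∞` field `V : ℝ³ → ℝ³` with `V ∈ L⁶`, `DV ∈ L²`, `D²V ∈ L²` (the shape of `w − c`, `w` in the stub's extended
class, `c` its far-field limit) the solenoidal truncations `Ψ_R = solenoidalTruncation V R` satisfy

* `tendsto_lintegral_iteratedFDeriv_one_sub` — `∫ ‖D(Ψ_R − V)‖² → 0`,
* `tendsto_lintegral_iteratedFDeriv_two_sub` — `∫ ‖D²(Ψ_R − V)‖² → 0`  (`R → ∞`),

by the pointwise bounds of part 3b (`exists_truncation_error_bounds`), the `L²` tails of `DV`, `D²V` and of the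
ray averages of `DV`, `D²V` (the tree's `lintegral_sq_rayAverage`), and the annulus lemmas of part 2
(`tendsto_annulusMass_of_lintegral_pow_six`, `tendsto_annulus_sq_rayAverage`) for the non-`L²` terms `R⁻¹V`, `R⁻¹F`.

WHAT THIS IS NOT: nothing here is about Navier–Stokes solutions; the crux NET, rung N0 and NS regularity stay
OPEN — nothing here proves NS regularity. [folklore]
-/

noncomputable section

open Set Filter Topology MeasureTheory Metric Function
open scoped ENNReal NNReal Topology
open Literature.Analysis.FluidPDE Literature.Analysis

namespace Summit.NavierStokesRegularity.NavierStokesRegularity.Theorems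

-- the problem directory repeats the summit name (`NavierStokesRegularity/NavierStokesRegularity`)
set_option linter.dupNamespace false

namespace ExtremiserLiouville

/-! ## A squeeze lemma for `∫ f²` under a four-term pointwise bound -/

/-- **Squeeze for squared lower integrals.**  If eventually `f_R ≤ g₁ + C (g₂ + g₃ + g₄)` pointwise with measurable
`gᵢ`, `C < ∞`, and `∫ gᵢ(R)² → 0` for each `i`, then `∫ f_R² → 0`. [folklore] -/
theorem tendsto_lintegral_sq_of_le_four {f g₁ g₂ g₃ g₄ : ℝ → EuclideanSpace ℝ (Fin 3) → ℝ≥0∞} {C : ℝ≥0∞}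
    (hC : C ≠ ⊤) (hg₁ : ∀ R, Measurable (g₁ R)) (hg₂ : ∀ R, Measurable (g₂ R)) (hg₃ : ∀ R, Measurable (g₃ R))
    (hle : ∀ᶠ R in atTop, ∀ x, f R x ≤ g₁ R x + C * (g₂ R x + g₃ R x + g₄ R x))
    (h₁ : Tendsto (fun R => ∫⁻ x, g₁ R x ^ 2) atTop (𝓝 0)) (h₂ : Tendsto (fun R => ∫⁻ x, g₂ R x ^ 2) atTop (𝓝 0))
    (h₃ : Tendsto (fun R => ∫⁻ x, g₃ R x ^ 2) atTop (𝓝 0)) (h₄ : Tendsto (fun R => ∫⁻ x, g₄ R x ^ 2) atTop (𝓝 0)) :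
    Tendsto (fun R => ∫⁻ x, f R x ^ 2) atTop (𝓝 0) := by
  set D : ℝ≥0∞ := 64 * C ^ 2 with hD
  have hDtop : D ≠ ⊤ := ENNReal.mul_ne_top (by norm_num) (ENNReal.pow_ne_top hC)
  -- pointwise: `f² ≤ 4 g₁² + D (g₂² + g₃² + g₄²)`
  have hpt : ∀ᶠ R in atTop, ∀ x, f R x ^ 2 ≤
      4 * g₁ R x ^ 2 + D * g₂ R x ^ 2 + D * g₃ R x ^ 2 + D * g₄ R x ^ 2 := by
    filter_upwards [hle] with R hR x
    refine (pow_le_pow_left' (hR x) 2).trans ?_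
    have hS : (g₂ R x + g₃ R x + g₄ R x) ^ 2 ≤ 16 * (g₂ R x ^ 2 + g₃ R x ^ 2 + g₄ R x ^ 2) :=
      calc (g₂ R x + g₃ R x + g₄ R x) ^ 2 ≤ 4 * ((g₂ R x + g₃ R x) ^ 2 + g₄ R x ^ 2) := ENNReal.add_sq_le_four_mul _ _
        _ ≤ 4 * (4 * (g₂ R x ^ 2 + g₃ R x ^ 2) + 4 * g₄ R x ^ 2) := by
            gcongr
            · exact ENNReal.add_sq_le_four_mul _ _
            · exact le_mul_of_one_le_left zero_le (by norm_num)
        _ = 16 * (g₂ R x ^ 2 + g₃ R x ^ 2 + g₄ R x ^ 2) := by ring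
    calc (g₁ R x + C * (g₂ R x + g₃ R x + g₄ R x)) ^ 2
        ≤ 4 * (g₁ R x ^ 2 + (C * (g₂ R x + g₃ R x + g₄ R x)) ^ 2) := ENNReal.add_sq_le_four_mul _ _
      _ = 4 * g₁ R x ^ 2 + 4 * (C ^ 2 * (g₂ R x + g₃ R x + g₄ R x) ^ 2) := by ring
      _ ≤ 4 * g₁ R x ^ 2 + 4 * (C ^ 2 * (16 * (g₂ R x ^ 2 + g₃ R x ^ 2 + g₄ R x ^ 2))) := by gcongr
      _ = 4 * g₁ R x ^ 2 + D * g₂ R x ^ 2 + D * g₃ R x ^ 2 + D * g₄ R x ^ 2 := by rw [hD]; ring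
  -- integrate
  have hint : ∀ᶠ R in atTop, ∫⁻ x, f R x ^ 2 ≤
      4 * (∫⁻ x, g₁ R x ^ 2) + D * (∫⁻ x, g₂ R x ^ 2) + D * (∫⁻ x, g₃ R x ^ 2) + D * (∫⁻ x, g₄ R x ^ 2) := by
    filter_upwards [hpt] with R hR
    have m1 : Measurable fun x => 4 * g₁ R x ^ 2 := ((hg₁ R).pow_const _).const_mul _
    have m2 : Measurable fun x => D * g₂ R x ^ 2 := ((hg₂ R).pow_const _).const_mul _
    have m3 : Measurable fun x => D * g₃ R x ^ 2 := ((hg₃ R).pow_const _).const_mul _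
    have m12 : Measurable fun x => 4 * g₁ R x ^ 2 + D * g₂ R x ^ 2 := m1.add m2
    have m123 : Measurable fun x => 4 * g₁ R x ^ 2 + D * g₂ R x ^ 2 + D * g₃ R x ^ 2 := m12.add m3
    calc ∫⁻ x, f R x ^ 2
        ≤ ∫⁻ x, (4 * g₁ R x ^ 2 + D * g₂ R x ^ 2 + D * g₃ R x ^ 2 + D * g₄ R x ^ 2) := lintegral_mono (hR)
      _ = 4 * (∫⁻ x, g₁ R x ^ 2) + D * (∫⁻ x, g₂ R x ^ 2) + D * (∫⁻ x, g₃ R x ^ 2) + D * (∫⁻ x, g₄ R x ^ 2) := by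
          rw [lintegral_add_left m123, lintegral_add_left m12, lintegral_add_left m1,
            lintegral_const_mul' _ _ (by norm_num), lintegral_const_mul' _ _ hDtop, lintegral_const_mul' _ _ hDtop,
            lintegral_const_mul' _ _ hDtop]
  -- the limit
  have hlim : Tendsto (fun R => 4 * (∫⁻ x, g₁ R x ^ 2) + D * (∫⁻ x, g₂ R x ^ 2) + D * (∫⁻ x, g₃ R x ^ 2) +
      D * (∫⁻ x, g₄ R x ^ 2)) atTop (𝓝 0) := by
    have t1 := ENNReal.Tendsto.const_mul h₁ (Or.inr (by norm_num : (4 : ℝ≥0∞) ≠ ⊤))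
    have t2 := ENNReal.Tendsto.const_mul h₂ (Or.inr hDtop)
    have t3 := ENNReal.Tendsto.const_mul h₃ (Or.inr hDtop)
    have t4 := ENNReal.Tendsto.const_mul h₄ (Or.inr hDtop)
    have := ((t1.add t2).add t3).add t4
    simpa using this
  exact tendsto_of_tendsto_of_tendsto_of_le_of_le' tendsto_const_nhds hlim (Eventually.of_forall fun _ => zero_le) hint

/-! ## The convergence of the derivatives of the truncation error -/

section Convergence

variable {V : EuclideanSpace ℝ (Fin 3) → EuclideanSpace ℝ (Fin 3)}

/-- `‖D¹f(x)‖ₑ = ‖Df(x)‖ₑ` and `‖D²f(x)‖ₑ = ‖D(Df)(x)‖ₑ` (extended norms). [folklore] -/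
theorem enorm_iteratedFDeriv_one_two {G : Type*} [NormedAddCommGroup G] [NormedSpace ℝ G]
    (f : EuclideanSpace ℝ (Fin 3) → G) (x : EuclideanSpace ℝ (Fin 3)) :
    ‖iteratedFDeriv ℝ 1 f x‖ₑ = ‖fderiv ℝ f x‖ₑ ∧ ‖iteratedFDeriv ℝ 2 f x‖ₑ = ‖fderiv ℝ (fderiv ℝ f) x‖ₑ := by
  constructor
  · calc ‖iteratedFDeriv ℝ 1 f x‖ₑ = ENNReal.ofReal ‖iteratedFDeriv ℝ 1 f x‖ := (ofReal_norm _).symm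
      _ = ENNReal.ofReal ‖fderiv ℝ f x‖ := by rw [norm_iteratedFDeriv_one]
      _ = ‖fderiv ℝ f x‖ₑ := by exact ofReal_norm (fderiv ℝ f x)
  · calc ‖iteratedFDeriv ℝ 2 f x‖ₑ = ENNReal.ofReal ‖iteratedFDeriv ℝ 2 f x‖ := (ofReal_norm _).symm
      _ = ENNReal.ofReal ‖fderiv ℝ (fderiv ℝ f) x‖ := by rw [norm_iteratedFDeriv_two_eq_norm_fderiv_fderiv_fin3]
      _ = ‖fderiv ℝ (fderiv ℝ f) x‖ₑ := by exact ofReal_norm (fderiv ℝ (fderiv ℝ f) x)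

/-- `‖D²F(x)‖ ≤ ∫₀¹ t³ ‖D²V(tx)‖ dt` with the Hessian written as `iteratedFDeriv ℝ 2 V` (multilinear form; avoids nested
operator spaces downstream). [folklore] -/
theorem enorm_iteratedFDeriv_two_poincareField_le' (hV : ContDiff ℝ 2 V) (x : EuclideanSpace ℝ (Fin 3)) :
    ‖iteratedFDeriv ℝ 2 (poincareField V) x‖ₑ ≤
      ∫⁻ t in Ioo (0 : ℝ) 1, ENNReal.ofReal (t ^ 3) * ‖iteratedFDeriv ℝ 2 V (t • x)‖ₑ := by
  refine (enorm_iteratedFDeriv_two_poincareField_le hV x).trans (le_of_eq (lintegral_congr fun t => ?_))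
  rw [(enorm_iteratedFDeriv_one_two V (t • x)).2]

/-- **`∫ ‖D(Ψ_R − V)‖² → 0`** for a smooth field with `V ∈ L⁶`, `DV ∈ L²`. [folklore] -/
theorem tendsto_lintegral_iteratedFDeriv_one_sub (hV : ContDiff ℝ (⊤ : ℕ∞) V)
    (hV6 : ∫⁻ x, ‖V x‖ₑ ^ 6 < ⊤) (hD1 : ∫⁻ x, ‖iteratedFDeriv ℝ 1 V x‖ₑ ^ 2 < ⊤) :
    Tendsto (fun R : ℝ => ∫⁻ x, ‖iteratedFDeriv ℝ 1 (fun x => solenoidalTruncation V R x - V x) x‖ₑ ^ 2)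
      atTop (𝓝 0) := by
  obtain ⟨K, hK0, hK⟩ := exists_truncation_error_bounds
  have hVc : Continuous V := hV.continuous
  have hV1 : ContDiff ℝ 1 V := contDiff_infty.1 hV 1
  have hDVc : Continuous (fderiv ℝ V) := hV.continuous_fderiv (by simp)
  -- `∫ ‖DV‖ₑ² < ⊤` in `fderiv` form
  have hDV2 : ∫⁻ x, ‖fderiv ℝ V x‖ₑ ^ 2 < ⊤ := by
    refine lt_of_le_of_lt (le_of_eq (lintegral_congr fun x => ?_)) hD1
    rw [(enorm_iteratedFDeriv_one_two V x).1]
  -- the annulus-mass majorant of `V ∈ L⁶`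
  obtain ⟨m, hm_anti, ⟨Q, hQ, hm_le⟩, hm_tend, hmass⟩ := tendsto_annulusMass_of_lintegral_pow_six hVc hV6
  -- the four majorants
  set I₁ : EuclideanSpace ℝ (Fin 3) → ℝ≥0∞ := fun x => ∫⁻ t in Ioo (0 : ℝ) 1, ENNReal.ofReal (t ^ 1) * ‖V (t • x)‖ₑ
    with hI₁
  set I₂ : EuclideanSpace ℝ (Fin 3) → ℝ≥0∞ := fun x =>
    ∫⁻ t in Ioo (0 : ℝ) 1, ENNReal.ofReal (t ^ 2) * ‖fderiv ℝ V (t • x)‖ₑ with hI₂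
  have hI₁m : Measurable I₁ := measurable_rayAverage hVc 1
  have hI₂m : Measurable I₂ := measurable_rayAverage hDVc 2
  set g₁ : ℝ → EuclideanSpace ℝ (Fin 3) → ℝ≥0∞ := fun R => {x : EuclideanSpace ℝ (Fin 3) | R ≤ ‖x‖}.indicator
    fun x => ‖fderiv ℝ V x‖ₑ with hg₁
  set g₂ : ℝ → EuclideanSpace ℝ (Fin 3) → ℝ≥0∞ := fun R =>
    {x : EuclideanSpace ℝ (Fin 3) | R ≤ ‖x‖ ∧ ‖x‖ ≤ 2 * R}.indicator fun x => ENNReal.ofReal R⁻¹ * ‖V x‖ₑ with hg₂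
  set g₃ : ℝ → EuclideanSpace ℝ (Fin 3) → ℝ≥0∞ := fun R => {x : EuclideanSpace ℝ (Fin 3) | R ≤ ‖x‖}.indicator I₂
    with hg₃
  set g₄ : ℝ → EuclideanSpace ℝ (Fin 3) → ℝ≥0∞ := fun R =>
    {x : EuclideanSpace ℝ (Fin 3) | R ≤ ‖x‖ ∧ ‖x‖ ≤ 2 * R}.indicator fun x => ENNReal.ofReal R⁻¹ * I₁ x with hg₄
  refine tendsto_lintegral_sq_of_le_four (C := ENNReal.ofReal K) ENNReal.ofReal_ne_top (g₁ := g₁) (g₂ := g₂)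
    (g₃ := g₃) (g₄ := g₄) ?_ ?_ ?_ ?_ ?_ ?_ ?_ ?_
  · intro R; exact (hDVc.measurable.enorm).indicator (measurableSet_norm_ge R)
  · intro R; exact ((hVc.measurable.enorm).const_mul _).indicator (measurableSet_annulus R)
  · intro R; exact hI₂m.indicator (measurableSet_norm_ge R)
  · -- the pointwise bound, for `R ≥ 1`
    filter_upwards [eventually_ge_atTop (1 : ℝ)] with R hR x
    have hR0 : 0 < R := one_pos.trans_le hR
    have hb := (hK V hV R hR x).2.1
    -- convert to `ℝ≥0∞`
    have hF : ‖poincareField V x‖ₑ ≤ I₁ x := enorm_poincareField_le x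
    have hDF : ‖iteratedFDeriv ℝ 1 (poincareField V) x‖ₑ ≤ I₂ x := by
      rw [(enorm_iteratedFDeriv_one_two (poincareField V) x).1]
      exact enorm_fderiv_poincareField_le hV1 x
    calc ‖iteratedFDeriv ℝ 1 (fun x => solenoidalTruncation V R x - V x) x‖ₑ
        = ENNReal.ofReal ‖iteratedFDeriv ℝ 1 (fun x => solenoidalTruncation V R x - V x) x‖ := (ofReal_norm _).symm
      _ ≤ ENNReal.ofReal ({x : EuclideanSpace ℝ (Fin 3) | R ≤ ‖x‖}.indicator (fun x => ‖iteratedFDeriv ℝ 1 V x‖) x +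
            {x : EuclideanSpace ℝ (Fin 3) | R ≤ ‖x‖ ∧ ‖x‖ ≤ 2 * R}.indicator (fun x => K * (R⁻¹ * ‖V x‖ +
              ‖iteratedFDeriv ℝ 1 (poincareField V) x‖ + R⁻¹ * ‖poincareField V x‖)) x) := ENNReal.ofReal_le_ofReal hb
      _ ≤ g₁ R x + ENNReal.ofReal K * (g₂ R x + g₃ R x + g₄ R x) := by
          by_cases hxA : x ∈ {x : EuclideanSpace ℝ (Fin 3) | R ≤ ‖x‖ ∧ ‖x‖ ≤ 2 * R}
          · have hxR : x ∈ {x : EuclideanSpace ℝ (Fin 3) | R ≤ ‖x‖} := hxA.1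
            simp only [hg₁, hg₂, hg₃, hg₄, indicator_of_mem hxA, indicator_of_mem hxR]
            rw [ENNReal.ofReal_add (norm_nonneg _) (by positivity), ofReal_norm,
              (enorm_iteratedFDeriv_one_two V x).1, ENNReal.ofReal_mul hK0,
              ENNReal.ofReal_add (by positivity) (by positivity), ENNReal.ofReal_add (by positivity) (by positivity),
              ENNReal.ofReal_mul (inv_nonneg.2 hR0.le), ENNReal.ofReal_mul (inv_nonneg.2 hR0.le), ofReal_norm, ofReal_norm,
              ofReal_norm]
            gcongr
          · have hA0 : {x : EuclideanSpace ℝ (Fin 3) | R ≤ ‖x‖ ∧ ‖x‖ ≤ 2 * R}.indicator (fun x => K * (R⁻¹ * ‖V x‖ +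
                ‖iteratedFDeriv ℝ 1 (poincareField V) x‖ + R⁻¹ * ‖poincareField V x‖)) x = 0 :=
              indicator_of_notMem hxA _
            rw [hA0, add_zero]
            by_cases hxR : x ∈ {x : EuclideanSpace ℝ (Fin 3) | R ≤ ‖x‖}
            · simp only [hg₁, indicator_of_mem hxR]
              rw [ofReal_norm, (enorm_iteratedFDeriv_one_two V x).1]
              exact le_self_add
            · simp only [indicator_of_notMem hxR, ENNReal.ofReal_zero]
              exact zero_le
  · -- `∫_{‖x‖≥R} ‖DV‖² → 0`
    have h := tendsto_setLIntegral_norm_ge (μ := (volume : Measure (EuclideanSpace ℝ (Fin 3))))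
      (hDVc.measurable.enorm.pow_const 2) hDV2.ne
    refine h.congr' (Eventually.of_forall fun R => ?_)
    rw [← lintegral_indicator (measurableSet_norm_ge R)]
    refine lintegral_congr fun x => ?_
    by_cases hx : x ∈ {x : EuclideanSpace ℝ (Fin 3) | R ≤ ‖x‖}
    · simp only [hg₁, indicator_of_mem hx]
    · simp only [hg₁, indicator_of_notMem hx, ne_eq, OfNat.ofNat_ne_zero, not_false_eq_true, zero_pow]
  · -- the annulus mass `R⁻² ∫_{A_R} ‖V‖² ≤ m(R) → 0`
    refine tendsto_of_tendsto_of_tendsto_of_le_of_le' tendsto_const_nhds hm_tend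
      (Eventually.of_forall fun _ => zero_le) ?_
    filter_upwards [eventually_gt_atTop (0 : ℝ)] with R hR
    refine le_trans (le_of_eq ?_) (hmass R hR)
    rw [← lintegral_indicator (measurableSet_annulus R), ← lintegral_const_mul' _ _ ENNReal.ofReal_ne_top]
    refine lintegral_congr fun x => ?_
    by_cases hx : x ∈ {x : EuclideanSpace ℝ (Fin 3) | R ≤ ‖x‖ ∧ ‖x‖ ≤ 2 * R}
    · simp only [hg₂, indicator_of_mem hx]
      rw [mul_pow, ← ENNReal.ofReal_pow (inv_nonneg.2 hR.le), inv_pow]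
    · simp only [hg₂, indicator_of_notMem hx, mul_zero, ne_eq, OfNat.ofNat_ne_zero, not_false_eq_true, zero_pow]
  · -- `∫_{‖x‖≥R} I₂² → 0`
    have h := (lintegral_sq_rayAverage (E := EuclideanSpace ℝ (Fin 3)) (finrank_euclideanSpace_fin) hDVc hDV2
      (k := 2) (by norm_num)).2
    refine h.congr' (Eventually.of_forall fun R => ?_)
    rw [← lintegral_indicator (measurableSet_norm_ge R)]
    refine lintegral_congr fun x => ?_
    by_cases hx : x ∈ {x : EuclideanSpace ℝ (Fin 3) | R ≤ ‖x‖}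
    · simp only [hg₃, hI₂, indicator_of_mem hx]
    · simp only [hg₃, indicator_of_notMem hx, ne_eq, OfNat.ofNat_ne_zero, not_false_eq_true, zero_pow]
  · -- the annulus tail of the ray average `R⁻² ∫_{A_R} I₁² → 0`
    have h := tendsto_annulus_sq_rayAverage hVc hm_anti hQ hm_le hm_tend hmass
    refine h.congr' ?_
    filter_upwards [eventually_gt_atTop (0 : ℝ)] with R hR
    rw [← lintegral_indicator (measurableSet_annulus R), ← lintegral_const_mul' _ _ ENNReal.ofReal_ne_top]
    refine lintegral_congr fun x => ?_
    by_cases hx : x ∈ {x : EuclideanSpace ℝ (Fin 3) | R ≤ ‖x‖ ∧ ‖x‖ ≤ 2 * R}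
    · simp only [hg₄, indicator_of_mem hx, hI₁]
      rw [mul_pow, ← ENNReal.ofReal_pow (inv_nonneg.2 hR.le), inv_pow]
    · simp only [hg₄, indicator_of_notMem hx, mul_zero, ne_eq, OfNat.ofNat_ne_zero, not_false_eq_true, zero_pow]

/-- Squeeze for three summands: `∫ (g₄ + g₅ + g₆)² → 0` if each `∫ gᵢ² → 0`. [folklore] -/
theorem tendsto_lintegral_sq_add_three {g₄ g₅ g₆ : ℝ → EuclideanSpace ℝ (Fin 3) → ℝ≥0∞}
    (hg₄ : ∀ R, Measurable (g₄ R)) (hg₅ : ∀ R, Measurable (g₅ R))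
    (h₄ : Tendsto (fun R => ∫⁻ x, g₄ R x ^ 2) atTop (𝓝 0)) (h₅ : Tendsto (fun R => ∫⁻ x, g₅ R x ^ 2) atTop (𝓝 0))
    (h₆ : Tendsto (fun R => ∫⁻ x, g₆ R x ^ 2) atTop (𝓝 0)) :
    Tendsto (fun R => ∫⁻ x, (g₄ R x + g₅ R x + g₆ R x) ^ 2) atTop (𝓝 0) := by
  have hpt : ∀ R x, (g₄ R x + g₅ R x + g₆ R x) ^ 2 ≤ 16 * g₄ R x ^ 2 + 16 * g₅ R x ^ 2 + 4 * g₆ R x ^ 2 := by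
    intro R x
    calc (g₄ R x + g₅ R x + g₆ R x) ^ 2 ≤ 4 * ((g₄ R x + g₅ R x) ^ 2 + g₆ R x ^ 2) := ENNReal.add_sq_le_four_mul _ _
      _ ≤ 4 * (4 * (g₄ R x ^ 2 + g₅ R x ^ 2) + g₆ R x ^ 2) := by gcongr; exact ENNReal.add_sq_le_four_mul _ _
      _ = 16 * g₄ R x ^ 2 + 16 * g₅ R x ^ 2 + 4 * g₆ R x ^ 2 := by ring
  have hint : ∀ R, ∫⁻ x, (g₄ R x + g₅ R x + g₆ R x) ^ 2 ≤
      16 * (∫⁻ x, g₄ R x ^ 2) + 16 * (∫⁻ x, g₅ R x ^ 2) + 4 * (∫⁻ x, g₆ R x ^ 2) := by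
    intro R
    have m4 : Measurable fun x => 16 * g₄ R x ^ 2 := ((hg₄ R).pow_const _).const_mul _
    have m5 : Measurable fun x => 16 * g₅ R x ^ 2 := ((hg₅ R).pow_const _).const_mul _
    have m45 : Measurable fun x => 16 * g₄ R x ^ 2 + 16 * g₅ R x ^ 2 := m4.add m5
    calc ∫⁻ x, (g₄ R x + g₅ R x + g₆ R x) ^ 2 ≤ ∫⁻ x, (16 * g₄ R x ^ 2 + 16 * g₅ R x ^ 2 + 4 * g₆ R x ^ 2) :=
          lintegral_mono (hpt R)
      _ = 16 * (∫⁻ x, g₄ R x ^ 2) + 16 * (∫⁻ x, g₅ R x ^ 2) + 4 * (∫⁻ x, g₆ R x ^ 2) := by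
          rw [lintegral_add_left m45, lintegral_add_left m4, lintegral_const_mul' _ _ (by norm_num),
            lintegral_const_mul' _ _ (by norm_num), lintegral_const_mul' _ _ (by norm_num)]
  have hlim : Tendsto (fun R => 16 * (∫⁻ x, g₄ R x ^ 2) + 16 * (∫⁻ x, g₅ R x ^ 2) + 4 * (∫⁻ x, g₆ R x ^ 2))
      atTop (𝓝 0) := by
    have t4 := ENNReal.Tendsto.const_mul h₄ (Or.inr (by norm_num : (16 : ℝ≥0∞) ≠ ⊤))
    have t5 := ENNReal.Tendsto.const_mul h₅ (Or.inr (by norm_num : (16 : ℝ≥0∞) ≠ ⊤))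
    have t6 := ENNReal.Tendsto.const_mul h₆ (Or.inr (by norm_num : (4 : ℝ≥0∞) ≠ ⊤))
    have := (t4.add t5).add t6
    simpa using this
  exact tendsto_of_tendsto_of_tendsto_of_le_of_le tendsto_const_nhds hlim (fun _ => zero_le) hint

/-- Exterior tails in indicator form. [folklore] -/
theorem tendsto_lintegral_indicator_sq_of_tail {G : EuclideanSpace ℝ (Fin 3) → ℝ≥0∞}
    (h : Tendsto (fun R : ℝ => ∫⁻ x in {x | R ≤ ‖x‖}, G x ^ 2) atTop (𝓝 0)) :
    Tendsto (fun R : ℝ => ∫⁻ x, ({x : EuclideanSpace ℝ (Fin 3) | R ≤ ‖x‖}.indicator G x) ^ 2) atTop (𝓝 0) := by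
  refine h.congr' (Eventually.of_forall fun R => ?_)
  rw [← lintegral_indicator (measurableSet_norm_ge R)]
  refine lintegral_congr fun x => ?_
  by_cases hx : x ∈ {x : EuclideanSpace ℝ (Fin 3) | R ≤ ‖x‖}
  · simp only [indicator_of_mem hx]
  · simp only [indicator_of_notMem hx, ne_eq, OfNat.ofNat_ne_zero, not_false_eq_true, zero_pow]

/-- Annulus terms with the factor `R⁻¹` in indicator form. [folklore] -/
theorem tendsto_lintegral_annulusIndicator_sq {G : EuclideanSpace ℝ (Fin 3) → ℝ≥0∞}
    (h : Tendsto (fun R : ℝ => ENNReal.ofReal ((R ^ 2)⁻¹) *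
      ∫⁻ x in {x : EuclideanSpace ℝ (Fin 3) | R ≤ ‖x‖ ∧ ‖x‖ ≤ 2 * R}, G x ^ 2) atTop (𝓝 0)) :
    Tendsto (fun R : ℝ => ∫⁻ x, ({x : EuclideanSpace ℝ (Fin 3) | R ≤ ‖x‖ ∧ ‖x‖ ≤ 2 * R}.indicator
      (fun x => ENNReal.ofReal R⁻¹ * G x) x) ^ 2) atTop (𝓝 0) := by
  refine h.congr' ?_
  filter_upwards [eventually_gt_atTop (0 : ℝ)] with R hR
  rw [← lintegral_indicator (measurableSet_annulus R), ← lintegral_const_mul' _ _ ENNReal.ofReal_ne_top]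
  refine lintegral_congr fun x => ?_
  by_cases hx : x ∈ {x : EuclideanSpace ℝ (Fin 3) | R ≤ ‖x‖ ∧ ‖x‖ ≤ 2 * R}
  · simp only [indicator_of_mem hx]
    rw [mul_pow, ← ENNReal.ofReal_pow (inv_nonneg.2 hR.le), inv_pow]
  · simp only [indicator_of_notMem hx, mul_zero, ne_eq, OfNat.ofNat_ne_zero, not_false_eq_true, zero_pow]

/-- The order-two pointwise bound of part 3b in extended form, with the ray-average majorants of `F`, `DF`, `D²F`
substituted. [folklore] -/
theorem enorm_iteratedFDeriv_two_sub_le (hV : ContDiff ℝ (⊤ : ℕ∞) V) {K R : ℝ} (hK0 : 0 ≤ K) (hR : 1 ≤ R)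
    (x : EuclideanSpace ℝ (Fin 3))
    (hb : ‖iteratedFDeriv ℝ 2 (fun x => solenoidalTruncation V R x - V x) x‖ ≤
      {x : EuclideanSpace ℝ (Fin 3) | R ≤ ‖x‖}.indicator (fun x => ‖iteratedFDeriv ℝ 2 V x‖) x +
        {x : EuclideanSpace ℝ (Fin 3) | R ≤ ‖x‖ ∧ ‖x‖ ≤ 2 * R}.indicator (fun x =>
          K * (‖iteratedFDeriv ℝ 1 V x‖ + R⁻¹ * ‖V x‖ + ‖iteratedFDeriv ℝ 2 (poincareField V) x‖ +
            ‖iteratedFDeriv ℝ 1 (poincareField V) x‖ + R⁻¹ * ‖poincareField V x‖)) x) :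
    ‖iteratedFDeriv ℝ 2 (fun x => solenoidalTruncation V R x - V x) x‖ₑ ≤
      {x : EuclideanSpace ℝ (Fin 3) | R ≤ ‖x‖}.indicator (fun x => ‖iteratedFDeriv ℝ 2 V x‖ₑ) x +
        ENNReal.ofReal K * ({x : EuclideanSpace ℝ (Fin 3) | R ≤ ‖x‖}.indicator (fun x => ‖fderiv ℝ V x‖ₑ) x +
          {x : EuclideanSpace ℝ (Fin 3) | R ≤ ‖x‖ ∧ ‖x‖ ≤ 2 * R}.indicator (fun x => ENNReal.ofReal R⁻¹ * ‖V x‖ₑ) x +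
          ({x : EuclideanSpace ℝ (Fin 3) | R ≤ ‖x‖}.indicator (fun x =>
              ∫⁻ t in Ioo (0 : ℝ) 1, ENNReal.ofReal (t ^ 3) * ‖iteratedFDeriv ℝ 2 V (t • x)‖ₑ) x +
            {x : EuclideanSpace ℝ (Fin 3) | R ≤ ‖x‖}.indicator (fun x =>
              ∫⁻ t in Ioo (0 : ℝ) 1, ENNReal.ofReal (t ^ 2) * ‖fderiv ℝ V (t • x)‖ₑ) x +
            {x : EuclideanSpace ℝ (Fin 3) | R ≤ ‖x‖ ∧ ‖x‖ ≤ 2 * R}.indicator (fun x => ENNReal.ofReal R⁻¹ *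
              ∫⁻ t in Ioo (0 : ℝ) 1, ENNReal.ofReal (t ^ 1) * ‖V (t • x)‖ₑ) x)) := by
  have hR0 : 0 < R := one_pos.trans_le hR
  have hV1 : ContDiff ℝ 1 V := contDiff_infty.1 hV 1
  have hV2 : ContDiff ℝ 2 V := contDiff_infty.1 hV 2
  have hF : ‖poincareField V x‖ₑ ≤ ∫⁻ t in Ioo (0 : ℝ) 1, ENNReal.ofReal (t ^ 1) * ‖V (t • x)‖ₑ :=
    enorm_poincareField_le x
  have hDF : ‖iteratedFDeriv ℝ 1 (poincareField V) x‖ₑ ≤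
      ∫⁻ t in Ioo (0 : ℝ) 1, ENNReal.ofReal (t ^ 2) * ‖fderiv ℝ V (t • x)‖ₑ := by
    rw [(enorm_iteratedFDeriv_one_two (poincareField V) x).1]
    exact enorm_fderiv_poincareField_le hV1 x
  have hD2F : ‖iteratedFDeriv ℝ 2 (poincareField V) x‖ₑ ≤
      ∫⁻ t in Ioo (0 : ℝ) 1, ENNReal.ofReal (t ^ 3) * ‖iteratedFDeriv ℝ 2 V (t • x)‖ₑ :=
    enorm_iteratedFDeriv_two_poincareField_le' hV2 x
  refine le_trans (le_of_eq (ofReal_norm _).symm) ((ENNReal.ofReal_le_ofReal hb).trans ?_)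
  by_cases hxA : x ∈ {x : EuclideanSpace ℝ (Fin 3) | R ≤ ‖x‖ ∧ ‖x‖ ≤ 2 * R}
  · have hxR : x ∈ {x : EuclideanSpace ℝ (Fin 3) | R ≤ ‖x‖} := hxA.1
    simp only [indicator_of_mem hxA, indicator_of_mem hxR]
    rw [ENNReal.ofReal_add (norm_nonneg _) (by positivity), ofReal_norm, ENNReal.ofReal_mul hK0,
      ENNReal.ofReal_add (by positivity) (by positivity), ENNReal.ofReal_add (by positivity) (by positivity),
      ENNReal.ofReal_add (by positivity) (by positivity), ENNReal.ofReal_add (by positivity) (by positivity),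
      ENNReal.ofReal_mul (inv_nonneg.2 hR0.le), ENNReal.ofReal_mul (inv_nonneg.2 hR0.le), ofReal_norm,
      (enorm_iteratedFDeriv_one_two V x).1, ofReal_norm, ofReal_norm, ofReal_norm, ofReal_norm]
    calc ‖iteratedFDeriv ℝ 2 V x‖ₑ + ENNReal.ofReal K * (‖fderiv ℝ V x‖ₑ + ENNReal.ofReal R⁻¹ * ‖V x‖ₑ +
          ‖iteratedFDeriv ℝ 2 (poincareField V) x‖ₑ + ‖iteratedFDeriv ℝ 1 (poincareField V) x‖ₑ +
          ENNReal.ofReal R⁻¹ * ‖poincareField V x‖ₑ)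
        = ‖iteratedFDeriv ℝ 2 V x‖ₑ + ENNReal.ofReal K * (‖fderiv ℝ V x‖ₑ + ENNReal.ofReal R⁻¹ * ‖V x‖ₑ +
          (‖iteratedFDeriv ℝ 2 (poincareField V) x‖ₑ + ‖iteratedFDeriv ℝ 1 (poincareField V) x‖ₑ +
          ENNReal.ofReal R⁻¹ * ‖poincareField V x‖ₑ)) := by simp only [add_assoc]
      _ ≤ _ := by gcongr
  · simp only [indicator_of_notMem hxA, add_zero]
    by_cases hxR : x ∈ {x : EuclideanSpace ℝ (Fin 3) | R ≤ ‖x‖}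
    · simp only [indicator_of_mem hxR]
      rw [ofReal_norm]
      exact le_self_add
    · simp only [indicator_of_notMem hxR, ENNReal.ofReal_zero]
      exact zero_le

/-- **`∫ ‖D²(Ψ_R − V)‖² → 0`** for a smooth field with `V ∈ L⁶`, `DV ∈ L²`, `D²V ∈ L²`. [folklore] -/
theorem tendsto_lintegral_iteratedFDeriv_two_sub (hV : ContDiff ℝ (⊤ : ℕ∞) V)
    (hV6 : ∫⁻ x, ‖V x‖ₑ ^ 6 < ⊤) (hD1 : ∫⁻ x, ‖iteratedFDeriv ℝ 1 V x‖ₑ ^ 2 < ⊤)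
    (hD2 : ∫⁻ x, ‖iteratedFDeriv ℝ 2 V x‖ₑ ^ 2 < ⊤) :
    Tendsto (fun R : ℝ => ∫⁻ x, ‖iteratedFDeriv ℝ 2 (fun x => solenoidalTruncation V R x - V x) x‖ₑ ^ 2)
      atTop (𝓝 0) := by
  obtain ⟨K, hK0, hK⟩ := exists_truncation_error_bounds
  have hVc : Continuous V := hV.continuous
  have hV2 : ContDiff ℝ 2 V := contDiff_infty.1 hV 2
  have hDVc : Continuous (fderiv ℝ V) := hV.continuous_fderiv (by simp)
  have hW2c : Continuous fun x => iteratedFDeriv ℝ 2 V x := hV2.continuous_iteratedFDeriv (by norm_num)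
  have hDV2 : ∫⁻ x, ‖fderiv ℝ V x‖ₑ ^ 2 < ⊤ := by
    refine lt_of_le_of_lt (le_of_eq (lintegral_congr fun x => ?_)) hD1
    rw [(enorm_iteratedFDeriv_one_two V x).1]
  obtain ⟨m, hm_anti, ⟨Q, hQ, hm_le⟩, hm_tend, hmass⟩ := tendsto_annulusMass_of_lintegral_pow_six hVc hV6
  have hI₁m : Measurable fun x : EuclideanSpace ℝ (Fin 3) =>
      ∫⁻ t in Ioo (0 : ℝ) 1, ENNReal.ofReal (t ^ 1) * ‖V (t • x)‖ₑ := measurable_rayAverage hVc 1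
  have hI₂m : Measurable fun x : EuclideanSpace ℝ (Fin 3) =>
      ∫⁻ t in Ioo (0 : ℝ) 1, ENNReal.ofReal (t ^ 2) * ‖fderiv ℝ V (t • x)‖ₑ := measurable_rayAverage hDVc 2
  have hI₃m : Measurable fun x : EuclideanSpace ℝ (Fin 3) =>
      ∫⁻ t in Ioo (0 : ℝ) 1, ENNReal.ofReal (t ^ 3) * ‖iteratedFDeriv ℝ 2 V (t • x)‖ₑ := measurable_rayAverage hW2c 3
  -- the six vanishing integrals
  have h₁ := tendsto_lintegral_indicator_sq_of_tail
    (tendsto_setLIntegral_norm_ge (μ := (volume : Measure (EuclideanSpace ℝ (Fin 3))))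
      (hW2c.enorm.measurable.pow_const 2) hD2.ne)
  have h₂ := tendsto_lintegral_indicator_sq_of_tail
    (tendsto_setLIntegral_norm_ge (μ := (volume : Measure (EuclideanSpace ℝ (Fin 3))))
      (hDVc.measurable.enorm.pow_const 2) hDV2.ne)
  have h₃ : Tendsto (fun R : ℝ => ∫⁻ x, ({x : EuclideanSpace ℝ (Fin 3) | R ≤ ‖x‖ ∧ ‖x‖ ≤ 2 * R}.indicator
      (fun x => ENNReal.ofReal R⁻¹ * ‖V x‖ₑ) x) ^ 2) atTop (𝓝 0) := by
    refine tendsto_lintegral_annulusIndicator_sq (tendsto_of_tendsto_of_tendsto_of_le_of_le' tendsto_const_nhds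
      hm_tend (Eventually.of_forall fun _ => zero_le) ?_)
    filter_upwards [eventually_gt_atTop (0 : ℝ)] with R hR using hmass R hR
  have h₄ := tendsto_lintegral_indicator_sq_of_tail
    (lintegral_sq_rayAverage (E := EuclideanSpace ℝ (Fin 3)) finrank_euclideanSpace_fin hW2c hD2
      (k := 3) (by norm_num)).2
  have h₅ := tendsto_lintegral_indicator_sq_of_tail
    (lintegral_sq_rayAverage (E := EuclideanSpace ℝ (Fin 3)) finrank_euclideanSpace_fin hDVc hDV2
      (k := 2) (by norm_num)).2
  have h₆ := tendsto_lintegral_annulusIndicator_sq (tendsto_annulus_sq_rayAverage hVc hm_anti hQ hm_le hm_tend hmass)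
  have h456 := tendsto_lintegral_sq_add_three (fun R => hI₃m.indicator (measurableSet_norm_ge R))
    (fun R => hI₂m.indicator (measurableSet_norm_ge R)) h₄ h₅ h₆
  refine tendsto_lintegral_sq_of_le_four (C := ENNReal.ofReal K) ENNReal.ofReal_ne_top
    (fun R => hW2c.enorm.measurable.indicator (measurableSet_norm_ge R))
    (fun R => hDVc.measurable.enorm.indicator (measurableSet_norm_ge R))
    (fun R => ((hVc.measurable.enorm).const_mul _).indicator (measurableSet_annulus R)) ?_ h₁ h₂ h₃ h456
  filter_upwards [eventually_ge_atTop (1 : ℝ)] with R hR x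
  exact enorm_iteratedFDeriv_two_sub_le hV hK0 hR x (hK V hV R hR x).2.2

end Convergence

end ExtremiserLiouville

end Summit.NavierStokesRegularity.NavierStokesRegularity.Theorems

end
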